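import Literature.Probability.LatticeModels.FKIsingCylinderIdentityLocal
import Literature.Probability.Process.BrownianRunningSupTransfer
import HarnessLib

/-!
# FK-Ising interfaces and SLE_{16/3}: the moment clause of (M5′) is automatic

Topic `Literature/Probability/LatticeModels` (family `crit-ising`); theorems only, no definition
and no named fact. Sequel to `FKIsingCylinderIdentityLocal.lean` (the moment-free
identification (J₀) ∧ (D) ⟹ (L) ⟹ crit-ising.S17 (FK)).

The cylinder-identity data (M5′) of CDHKS §3 (Chelkak–Duminil-Copin–Hongler–Kemppainen–
Smirnov, C. R. Math. 352 (2014), Thm. 3 and §3; Duminil-Copin–Smirnov, Clay Math. Proc. 15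
(2012), proof of Prop. 6.7) — the hypotheses of `isSLELaw_sixteen_thirds_of_cylinderIdentity`
(`FKIsingCylinderIdentityAssembly.lean`); until the D-0026 review of 2026-08-15 also the closed
named fact `exists_cylinderObservableIdentity_fkInterface` of `FKIsingNaturalMartingale.lean`,
since merged back into the proof obligation — ask, for a subsequential limit law `μ` of the
critical FK-Ising interfaces and a chordal uniformizing map `φ`, for a regular version `W` of
the driving process with — among its six clauses — running maxima dominated by nonnegative `L³(μ)` functions (CDHKS Thm. 3:
"`sup_δ E[exp(ε|W^δ_t|/√t)] < ∞`", rendered as third moments, the input of the printed exchange of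
expansion and conditional expectation). This file PROVES that clause from the other five:

* `exists_memLp_forall_abs_le_of_cylinderIdentity` — strongly measurable marginals, continuous
  paths, `W 0 = 0` and the cylinder identity of the time-limited FK observables already force
  `(√(16/3))⁻¹ W` to be a Brownian motion under `μ` (monotone class ⟹ natural martingales ⟹
  localisation, `Loewner.isLocalMartingale_hasQuadraticVariation_of_fkObservable` ⟹ Lévy's
  characterisation), so its path law is the Wiener law and the `L⁴` bound on the running
  supremum of Brownian motion (Doob's `L²` inequality for `B_t² - t`,
  `Process/BrownianRunningSupFourthMoment.lean`, transferred along the path law by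
  `Process.exists_memLp_forall_abs_le_of_map_eq_map_brownian`) gives, for every `t` and `p ≤ 4`,
  a nonnegative `M ∈ Lᵖ(μ)` dominating `|W c u|`, `u ≤ t`, for every `c`;
* `exists_cylinderIdentityData_of_limitData₀` — hence **(J₀) ∧ (D) ⟹ the full body of (M5′)**
  for `(μ, φ)` ((J₀) = describability through `φ`, curves from `a`, convergence in distribution
  of the discrete driving processes: Kemppainen–Smirnov 2017, Thm. 1.5 / Cor. 1.7, NO Prop. 3.8
  tails; (D) = the discrete observable martingale data: DCS Lemma 6.6 + Smirnov 2010, Thm. 2.2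
  over the slit domains), by `exists_drivingData_of_limitData` and the previous theorem;
* `exists_observableMartingale_fkInterface_of_limitData₀` — the global form: (J₀) ∧ (D)
  for every limit and every uniformizing map ⟹ the layer-4 named fact (L‴)
  `exists_observableMartingale_fkInterface` (the clause "curves from `a`" being
  automatic, `ae_source_eq_of_isSubseqLimitLaw_fkInterfaceCurve`).

Consequently (M5′), the identification fact (L) `isSLELaw_of_isSubseqLimitLaw_fkInterfaceCurve`
and — given the RSW bound `fkIsing_rsw` — crit-ising.S17 (FK)
`convergesInLawToSLE_sixteen_thirds_fkInterface` all have the same named-fact-free frontier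
(J₀) ∧ (D) (`FKIsingCylinderIdentityLocal.lean`), Kemppainen–Smirnov's Prop. 3.8 having left it.

## References

* D. Chelkak, H. Duminil-Copin, C. Hongler, A. Kemppainen, S. Smirnov, *Convergence of Ising
  interfaces to Schramm's SLE curves*, C. R. Math. Acad. Sci. Paris 352 (2014) 157–161
  (arXiv:1312.0533): Thm. 2, Thm. 3, §3.
* H. Duminil-Copin, S. Smirnov, *Conformal invariance of lattice models*, Clay Math. Proc. 15
  (2012) 213–276 (arXiv:1109.1549): Thm. 6.4, Lemma 6.6, Prop. 6.7 and its proof (p. 29).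
* A. Kemppainen, S. Smirnov, *Random curves, scaling limits and Loewner evolutions*, Ann.
  Probab. 45 (2017) 698–779: Thm. 1.5, Cor. 1.7, Prop. 3.8.
* D. Revuz, M. Yor, *Continuous Martingales and Brownian Motion* (1999), Ch. II Thm (1.7),
  Ch. IV Thm (3.6).
-/

noncomputable section

open MeasureTheory ProbabilityTheory Filter Topology Set
open UpperHalfPlane (upperHalfPlaneSet)
open scoped NNReal ENNReal
open Literature.Probability.RandomPlanarGeometry Literature.Probability.LatticeModels
  Literature.Probability.Percolation Literature.Probability.Process

namespace Literature.Probability.LatticeModels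

open RandomPlanarGeometry.Loewner
open scoped Literature.Probability.RandomPlanarGeometry.PathBorel

/-! ### The moment clause of (M5′) from the cylinder identity alone -/

/-- **The running maxima of the driving process are in `Lᵖ`, `p ≤ 4`, as soon as the cylinder
identity holds** — with no a priori moment or tail hypothesis. For a probability measure `μ` on
curve classes and a process `W` with strongly measurable marginals, continuous paths, `W 0 = 0`
and the cylinder identity of its time-limited FK observables, the chain cylinder identity ⟹
natural-filtration martingales (`martingale_re_im_observableProcess_of_cylinder`) ⟹
`X = (√(16/3))⁻¹ W` a continuous local martingale with `⟨X⟩_t = t`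
(`Loewner.isLocalMartingale_hasQuadraticVariation_of_fkObservable`) ⟹ `X` is a Brownian motion
under `μ` (Lévy, `Process.levy_characterisation_holds`) identifies the PATH LAW of `X` with the
Wiener law (`map_paths_eq_map_brownianPath`), along which the `L⁴` bound on the running supremum
of Brownian motion (Doob's inequality, `Process.exists_memLp_forall_abs_le_of_map_eq_map_brownian`)
transfers: for every `t` there is a nonnegative `M ∈ Lᵖ(μ)` with `|W c u| ≤ M c` for all `c` and
all `u ≤ t`. In particular the `L³` clause of the cylinder-identity data (M5′) — CDHKS Thm. 3's "`E[exp(ε|W_t|/√t)] < ∞`" rendered as third moments — is a CONSEQUENCE of its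
other clauses (no uniformizing map and no Loewner regularity are used).
[cite: CDHKSCRAS2014, Thm. 3 and §3] [cite: DuminilCopinSmirnov2012Clay, Prop. 6.7 (proof, p. 29)] -/
theorem exists_memLp_forall_abs_le_of_cylinderIdentity
    {μ : Measure (CurveClass ℂ)} [IsProbabilityMeasure μ] {W : CurveClass ℂ → ℝ≥0 → ℝ}
    (hW : ∀ t, StronglyMeasurable (fun c ↦ W c t)) (hWc : ∀ c, Continuous (W c))
    (hW0 : ∀ c, W c 0 = 0)
    (hcyl : ∀ y : ℝ, 0 < y → ∀ s t : ℝ≥0, s ≤ t → ∀ (n : ℕ) (S : Fin n → ℝ≥0), (∀ k, S k ≤ s) →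
      ∀ ψ : (Fin n → ℝ) → ℝ, Continuous ψ → (∀ v, |ψ v| ≤ 1) →
        ∫ c, (observableProcess (fun t c ↦ W c t) y t c -
            observableProcess (fun t c ↦ W c t) y s c) * (ψ (fun k ↦ W c (S k)) : ℂ) ∂μ = 0)
    (t : ℝ≥0) {p : ℝ≥0∞} (hp : p ≤ 4) :
    ∃ M : CurveClass ℂ → ℝ, MemLp M p μ ∧ (∀ c, 0 ≤ M c) ∧ ∀ c u, u ≤ t → |W c u| ≤ M c := by
  -- natural-filtration martingales (monotone class)
  have hmart : ∀ y : ℝ, 0 < y →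
      Martingale (fun t c ↦ (observableProcess (fun t c ↦ W c t) y t c).re)
        (Filtration.natural (fun t c ↦ W c t) hW) μ ∧
      Martingale (fun t c ↦ (observableProcess (fun t c ↦ W c t) y t c).im)
        (Filtration.natural (fun t c ↦ W c t) hW) μ := fun y hy ↦
    martingale_re_im_observableProcess_of_cylinder (W := fun t c ↦ W c t) hW hWc hy (hcyl y hy)
  set 𝓕 := Filtration.natural (fun t c ↦ W c t) hW with h𝓕
  have hWad : StronglyAdapted 𝓕 (fun t c ↦ W c t) := Filtration.stronglyAdapted_natural hW
  -- localisation: `(√(16/3))⁻¹ W` is a continuous local martingale with `⟨·⟩_t = t`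
  obtain ⟨hM, hQ⟩ := isLocalMartingale_hasQuadraticVariation_of_fkObservable (W := fun t c ↦ W c t)
    (P := μ) hWad hWc hW0 (y₀ := 1) (fun y hy ↦ (hmart y (by linarith)).1)
    (fun y hy ↦ (hmart y (by linarith)).2)
  -- Lévy: `X = (√(16/3))⁻¹ W` is a Brownian motion under `μ`
  set X : ℝ≥0 → CurveClass ℂ → ℝ := fun t c ↦ (Real.sqrt (16 / 3))⁻¹ * W c t with hX
  have hXm : ∀ t, Measurable (X t) := fun t ↦ (hW t).measurable.const_mul _
  have hXc : ∀ c, Continuous (X · c) := fun c ↦ continuous_const.mul (hWc c)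
  have hX0 : ∀ᵐ c ∂μ, X 0 c = 0 := ae_of_all _ fun c ↦ by simp [hX, hW0]
  have hBM : IsBrownianReal X μ :=
    Process.levy_characterisation_holds (Ω := CurveClass ℂ) (m := inferInstance) hM hX0
      (ae_of_all _ hXc) hQ
  -- its path law is the Wiener law of the canonical Brownian path
  have hlaw : μ.map (fun c t ↦ X t c) =
      Process.preWienerMeasure.map (fun ω t ↦ Process.brownian t ω) :=
    map_paths_eq_map_brownianPath hBM.toIsPreBrownianReal hXm
  -- transfer of the `L⁴` running-supremum bound
  obtain ⟨M, hMp, hM0, hdom⟩ :=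
    Process.exists_memLp_forall_abs_le_of_map_eq_map_brownian hXm hXc hlaw t hp
  have hs : 0 < Real.sqrt (16 / 3) := Real.sqrt_pos.2 (by norm_num)
  refine ⟨fun c ↦ Real.sqrt (16 / 3) * M c, hMp.const_mul _,
    fun c ↦ mul_nonneg hs.le (hM0 c), fun c u hu ↦ ?_⟩
  have hWX : W c u = Real.sqrt (16 / 3) * X u c := by
    simp only [hX]
    rw [← mul_assoc, mul_inv_cancel₀ hs.ne', one_mul]
  rw [hWX, abs_mul, abs_of_pos hs]
  exact mul_le_mul_of_nonneg_left (hdom c u hu) hs.le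

/-! ### (J₀) ∧ (D) ⟹ the body of (M5′), for one limit law and one uniformizing map -/

section LimitData

variable {D : DobrushinDomain} {φ : ConformalEquiv upperHalfPlaneSet D.carrier}
  {μ : Measure (CurveClass ℂ)} [IsProbabilityMeasure μ]
  {Ω' : ℕ → Type*} {mΩ' : ∀ k, MeasurableSpace (Ω' k)} {P : ∀ k, Measure (Ω' k)}
  [∀ k, IsProbabilityMeasure (P k)] {V : ∀ k, ℝ≥0 → Ω' k → ℝ}

/-- **The body of (M5′) for one subsequential limit, from the moment-free Kemppainen–Smirnov
data (J₀) and the discrete observable martingales (D)** — all six clauses of the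
cylinder-identity data (the hypotheses of `isSLELaw_sixteen_thirds_of_cylinderIdentity`) for
`(μ, φ)`, including the `L³` running maxima,
from the describability of the limit through `φ`, curves from `a`, the convergence in
distribution of the discrete driving processes to `drivingFunction φ` (Kemppainen–Smirnov 2017,
Thm. 1.5 / Cor. 1.7; CDHKS Thm. 3 with Thm. 4) and the discrete martingale data (DCS Lemma 6.6,
Smirnov 2010 Thm. 2.2) — with NO tail hypothesis: the moment clause is supplied by
`exists_memLp_forall_abs_le_of_cylinderIdentity`. The tail-free form of
`exists_cylinderIdentityData_of_limitData`.
[cite: CDHKSCRAS2014, Thm. 3 and §3] [cite: DuminilCopinSmirnov2012Clay, Thm. 6.4, Lemma 6.6 and proof of Prop. 6.7 (p. 29)] -/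
theorem exists_cylinderIdentityData_of_limitData₀ (hφ : D.IsChordalUniformizing φ)
    (hdesc : ∀ᵐ c ∂μ, IsLoewnerDescribable φ c) (hsrc : ∀ᵐ c ∂μ, c.source = D.pt 0)
    (hVc : ∀ k ω, Continuous (V k · ω))
    (hlaw : TendstoInDistribution (fun k ω ↦ (⟨fun u ↦ V k u ω, hVc k ω⟩ : C(ℝ≥0, ℝ))) atTop
      (fun c ↦ (⟨drivingFunction φ c, continuous_drivingFunction φ c⟩ : C(ℝ≥0, ℝ))) P μ)
    (hD : ∀ y : ℝ, 0 < y → ∀ s t : ℝ≥0, s < t → t < cdhksTime y →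
      ∃ (C' : ℝ) (ε Δ η : ℕ → ℝ≥0), Tendsto ε atTop (𝓝 0) ∧ Tendsto Δ atTop (𝓝 0) ∧
        Tendsto η atTop (𝓝 0) ∧
        ∀ k, ∃ (𝒢 : Filtration ℕ (mΩ' k)) (F : ℕ → Ω' k → ℂ) (σ τ : Ω' k → WithTop ℕ)
          (hσ : IsStoppingTime 𝒢 σ) (M : ℕ) (bad : Set (Ω' k)),
          IsStoppingTime 𝒢 τ ∧ Martingale F 𝒢 (P k) ∧ σ ≤ τ ∧ (∀ ω, τ ω ≤ M) ∧
          (∀ u, u ≤ s → Measurable[hσ.measurableSpace] (V k u)) ∧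
          (∀ᵐ ω ∂P k, ‖stoppedValue F σ ω‖ ≤ C') ∧ (∀ᵐ ω ∂P k, ‖stoppedValue F τ ω‖ ≤ C') ∧
          MeasurableSet bad ∧ P k bad ≤ η k ∧
          ∀ᵐ ω ∂P k, ω ∉ bad →
            (∃ u ∈ Icc s (s + Δ k), ‖stoppedValue F σ ω - observableProcess (V k) y u ω‖ ≤ ε k) ∧
            (∃ u ∈ Icc t (t + Δ k), ‖stoppedValue F τ ω - observableProcess (V k) y u ω‖ ≤ ε k)) :
    ∃ W : CurveClass ℂ → ℝ≥0 → ℝ,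
      (∀ t, StronglyMeasurable (fun c ↦ W c t)) ∧ (∀ c, Continuous (W c)) ∧ (∀ c, W c 0 = 0) ∧
      (∀ t : ℝ≥0, ∃ M : CurveClass ℂ → ℝ, MemLp M 3 μ ∧ (∀ c, 0 ≤ M c) ∧
        ∀ᵐ c ∂μ, ∀ u, u ≤ t → |W c u| ≤ M c) ∧
      (∀ᵐ c ∂μ, Loewner.IsDrivenBy φ.boundaryExtension (D.pt 1) (W c) c) ∧
      ∀ y : ℝ, 0 < y → ∀ s t : ℝ≥0, s ≤ t → ∀ (n : ℕ) (S : Fin n → ℝ≥0), (∀ k, S k ≤ s) →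
        ∀ ψ : (Fin n → ℝ) → ℝ, Continuous ψ → (∀ v, |ψ v| ≤ 1) →
          ∫ c, (observableProcess (fun t c ↦ W c t) y t c -
              observableProcess (fun t c ↦ W c t) y s c) * (ψ (fun k ↦ W c (S k)) : ℂ) ∂μ = 0 := by
  obtain ⟨W, hW, hWc, hW0, hdrv, hcyl⟩ := exists_drivingData_of_limitData hφ hdesc hsrc hVc hlaw hD
  refine ⟨W, hW, hWc, hW0, fun t ↦ ?_, hdrv, hcyl⟩
  obtain ⟨M, hM, hM0, hdom⟩ :=
    exists_memLp_forall_abs_le_of_cylinderIdentity hW hWc hW0 hcyl t (p := 3) (by norm_num)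
  exact ⟨M, hM, hM0, ae_of_all _ fun c u hu ↦ hdom c u hu⟩

end LimitData

/-! ### Global form: (J₀) ∧ (D) for every limit ⟹ (M5′)-data ⟹ (L‴) -/

/-- **(L‴) from the moment-free limit data (J₀) ∧ (D).** If for every Dobrushin domain
`(D; a, b)`, every family of admissible discretisations `E`, every subsequential limit law `μ` of
the critical FK-Ising interface laws and every chordal uniformizing map `φ`: `μ`-a.e. curve class
is describable through `φ` (Kemppainen–Smirnov 2017, Thm. 1.5; CDHKS Thm. 3 with Thm. 4), some
discrete driving processes `V^k` on probability spaces `(Ω' k, P k)` converge in distribution in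
`C([0, ∞), ℝ)` to `drivingFunction φ` (KS Cor. 1.7), and the discrete observable martingale data
(D) hold (DCS Lemma 6.6, Smirnov 2010 Thm. 2.2 over the slit domains), then the layer-4 named
fact (L‴) `exists_observableMartingale_fkInterface` (`FKIsingObservableMartingale.lean`: the FK
observable of every subsequential limit, stopped at the far-field stopping times, is a martingale
for a version of the driving process) holds — through the full cylinder-identity data (M5′), `L³`
clause included with no tail input (`exists_cylinderIdentityData_of_limitData₀`; cf.
`exists_observableMartingale_fkInterface_of_limitData` and its primed form, which consume
Kemppainen–Smirnov's Prop. 3.8 tails), the monotone-class bridge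
`martingale_re_im_observableProcess_of_cylinder` and optional stopping
(`Loewner.martingale_re_stoppedObservable`, `Loewner.martingale_im_stoppedObservable`); the clause
"curves from `a`" is automatic (`ae_source_eq_of_isSubseqLimitLaw_fkInterfaceCurve`). So (L‴),
(L) and crit-ising.S17 (FK) (`convergesInLawToSLE_sixteen_thirds_fkInterface_of_fkIsing_rsw_of_limitData'`,
given `fkIsing_rsw`) have one and the same named-fact-free frontier: (J₀) ∧ (D).
[cite: CDHKSCRAS2014, Thm. 2 (proof, §3) and Thm. 3] [cite: DuminilCopinSmirnov2012Clay, Thm. 6.4, Lemma 6.6 and Prop. 6.7] -/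
theorem exists_observableMartingale_fkInterface_of_limitData₀
    (h : ∀ (D : DobrushinDomain) (E : ℝ → DiscreteDobrushin), IsDiscretisation D E →
      ∀ (μ : Measure (CurveClass ℂ)) [IsProbabilityMeasure μ],
        IsSubseqLimitLaw (Ωδ := fun _ ↦ BondConfig (Site 2))
          (fun δ ↦ fkInterfaceCurve D (E δ)) (fun δ ↦ fkDobrushinMeasure (E δ)) μ →
        ∀ φ : ConformalEquiv upperHalfPlaneSet D.carrier, D.IsChordalUniformizing φ →
          (∀ᵐ c ∂μ, IsLoewnerDescribable φ c) ∧
          ∃ (Ω' : ℕ → Type) (mΩ' : ∀ k, MeasurableSpace (Ω' k)) (P : ∀ k, Measure (Ω' k))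
            (_ : ∀ k, IsProbabilityMeasure (P k)) (V : ∀ k, ℝ≥0 → Ω' k → ℝ)
            (hVc : ∀ k ω, Continuous (V k · ω)),
            TendstoInDistribution (fun k ω ↦ (⟨fun u ↦ V k u ω, hVc k ω⟩ : C(ℝ≥0, ℝ))) atTop
              (fun c ↦ (⟨drivingFunction φ c, continuous_drivingFunction φ c⟩ : C(ℝ≥0, ℝ))) P μ ∧
            (∀ y : ℝ, 0 < y → ∀ s t : ℝ≥0, s < t → t < cdhksTime y →
              ∃ (C' : ℝ) (ε Δ η : ℕ → ℝ≥0), Tendsto ε atTop (𝓝 0) ∧ Tendsto Δ atTop (𝓝 0) ∧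
                Tendsto η atTop (𝓝 0) ∧
                ∀ k, ∃ (𝒢 : Filtration ℕ (mΩ' k)) (F : ℕ → Ω' k → ℂ) (σ τ : Ω' k → WithTop ℕ)
                  (hσ : IsStoppingTime 𝒢 σ) (M : ℕ) (bad : Set (Ω' k)),
                  IsStoppingTime 𝒢 τ ∧ Martingale F 𝒢 (P k) ∧ σ ≤ τ ∧ (∀ ω, τ ω ≤ M) ∧
                  (∀ u, u ≤ s → Measurable[hσ.measurableSpace] (V k u)) ∧
                  (∀ᵐ ω ∂P k, ‖stoppedValue F σ ω‖ ≤ C') ∧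
                  (∀ᵐ ω ∂P k, ‖stoppedValue F τ ω‖ ≤ C') ∧
                  MeasurableSet bad ∧ P k bad ≤ η k ∧
                  ∀ᵐ ω ∂P k, ω ∉ bad →
                    (∃ u ∈ Icc s (s + Δ k),
                      ‖stoppedValue F σ ω - observableProcess (V k) y u ω‖ ≤ ε k) ∧
                    (∃ u ∈ Icc t (t + Δ k),
                      ‖stoppedValue F τ ω - observableProcess (V k) y u ω‖ ≤ ε k))) :
    exists_observableMartingale_fkInterface := by
  intro D E hE μ hμ hlim φ hφ
  haveI := hμ
  obtain ⟨hdesc, Ω', mΩ', P, hP, V, hVc, hlaw, hD⟩ := h D E hE μ hlim φ hφ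
  obtain ⟨W, hW, hWc, hW0, hmom, hdrv, hcyl⟩ := exists_cylinderIdentityData_of_limitData₀ hφ hdesc
    (ae_source_eq_of_isSubseqLimitLaw_fkInterfaceCurve hE hlim) hVc hlaw hD
  have hWad : StronglyAdapted (Filtration.natural (fun t c ↦ W c t) hW) (fun t c ↦ W c t) :=
    Filtration.stronglyAdapted_natural hW
  refine ⟨W, Filtration.natural (fun t c ↦ W c t) hW, 1, hWad, hWc, hW0, hmom, hdrv,
    fun y hy ↦ ?_⟩
  have hy0 : 0 < y := by linarith
  have hm := martingale_re_im_observableProcess_of_cylinder (W := fun t c ↦ W c t) hW hWc hy0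
    (hcyl y hy0)
  exact ⟨martingale_re_stoppedObservable hWad hWc hy0 hm.1,
    martingale_im_stoppedObservable hWad hWc hy0 hm.2⟩

end Literature.Probability.LatticeModels
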